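import Literature.AlgebraicGeometry.Resolution.AlterationsNormalProjectiveStepLeaves
import Literature.AlgebraicGeometry.FundamentalGroup.ProjectiveLineSimplyConnectedHolds
import HarnessLib

/-!
# De Jong 1996, Thm. 4.1 over algebraically closed fields from THIRTEEN open leaves (`π₁(ℙ¹) = 0` discharged)

Topic: `Literature/AlgebraicGeometry/Resolution`. Bookkeeping (pure composition, no new named
fact): `AlterationsNormalProjectiveStepLeaves.lean` gives `DeJong1996NormalProjectiveStep`,
`DeJong1996StrongAlgClosed` and `DeJong1996Strong ∧ DeJong1996StrongPerfect ∧ DeJong1996Projective ∧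
DeJong1996` from fourteen named facts; one of them, `ProjectiveLineSimplyConnected` (SGA 1, XI 1.1
for `r = 1`: a connected finite étale cover of `ℙ¹` over an algebraically closed field is an
isomorphism — the input "`Y' = ℙ^{d-1}`" of 4.12 through `π₁(ℙ^{d-1}) = 0`), is now PROVED
(`FundamentalGroup.ProjectiveLineSimplyConnected_holds`,
`FundamentalGroup/ProjectiveLineSimplyConnectedHolds.lean`: Riemann–Hurwitz for the function field
`K(Y) ⊇ K(t)`, unramified everywhere). Feeding it in leaves the THIRTEEN hypotheses below:
five for 4.11–4.12 (`DeJong1996VertexBlowupProjection`, `DeJong1996Lemma411VertexChoice`,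
`steinFactorization_geometricallyConnected`, `DeJong1996SteinFactorizationEtale`,
`EtaleCoverHyperplaneSectionConnected`), four for 4.13–4.22 (`DeJong1996MultisectionHyperplane`,
`DeJong1996GaloisNormalization`, `DeJong1996StableExtension`, `DeJong1996RationalMapExtension`)
and four for 4.23–4.28 (`DeJong1996NodeLocalStructure`, `DeJong1996NodeLocalStructureCodimTwo`,
`DeJong1996SemiStableCodimTwoBlowupCore`, `DeJong1996NodalBlowupSingularLocus`).

## Sources

* A. J. de Jong, *Smoothness, semi-stability and alterations*, Publ. Math. IHÉS 83 (1996) 51–93: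
  Thm. 4.1 (p. 66), 4.11–4.12 (pp. 67–69), 4.13–4.28 (pp. 69–76).
* A. Grothendieck, M. Raynaud, SGA 1, Exp. XI Prop. 1.1.
-/

noncomputable section

open CategoryTheory AlgebraicGeometry

namespace Literature.AlgebraicGeometry.Resolution

universe u

open Literature.AlgebraicGeometry.Morphisms Literature.AlgebraicGeometry.FundamentalGroup

/-- **4.11–4.28 (`DeJong1996NormalProjectiveStep`) from thirteen open leaves**, `π₁(ℙ¹) = 0`
being proved (`ProjectiveLineSimplyConnected_holds`). [cite: DeJong1996, 4.11–4.28, pp. 67–76] -/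
theorem DeJong1996NormalProjectiveStep.of_openLeaves₁₃
    -- 4.11–4.12
    (hV : DeJong1996VertexBlowupProjection.{u}) (hC : DeJong1996Lemma411VertexChoice.{u})
    (hZ : steinFactorization_geometricallyConnected.{u}) (hE : DeJong1996SteinFactorizationEtale.{u})
    (hH : EtaleCoverHyperplaneSectionConnected.{u})
    -- 4.13–4.22
    (h13 : DeJong1996MultisectionHyperplane.{u}) (h16 : DeJong1996GaloisNormalization.{u})
    (h17 : DeJong1996StableExtension.{u}) (h18 : DeJong1996RationalMapExtension.{u})
    -- 4.23–4.28
    (hN : DeJong1996NodeLocalStructure.{u}) (hN₂ : DeJong1996NodeLocalStructureCodimTwo.{u})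
    (hK : DeJong1996SemiStableCodimTwoBlowupCore.{u}) (hS : DeJong1996NodalBlowupSingularLocus.{u}) :
    DeJong1996NormalProjectiveStep.{u} :=
  DeJong1996NormalProjectiveStep.of_openLeaves hV hC hZ hE ProjectiveLineSimplyConnected_holds hH
    h13 h16 h17 h18 hN hN₂ hK hS

/-- **Thm. 4.1 with its generically-étale clause over algebraically closed fields
(`DeJong1996StrongAlgClosed`) from thirteen open leaves.** [cite: DeJong1996, Thm. 4.1 and 4.3–4.28, pp. 66–76] -/
theorem DeJong1996StrongAlgClosed.of_openLeaves₁₃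
    (hV : DeJong1996VertexBlowupProjection.{u}) (hC : DeJong1996Lemma411VertexChoice.{u})
    (hZ : steinFactorization_geometricallyConnected.{u}) (hE : DeJong1996SteinFactorizationEtale.{u})
    (hH : EtaleCoverHyperplaneSectionConnected.{u})
    (h13 : DeJong1996MultisectionHyperplane.{u}) (h16 : DeJong1996GaloisNormalization.{u})
    (h17 : DeJong1996StableExtension.{u}) (h18 : DeJong1996RationalMapExtension.{u})
    (hN : DeJong1996NodeLocalStructure.{u}) (hN₂ : DeJong1996NodeLocalStructureCodimTwo.{u})
    (hK : DeJong1996SemiStableCodimTwoBlowupCore.{u}) (hS : DeJong1996NodalBlowupSingularLocus.{u}) :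
    DeJong1996StrongAlgClosed.{u} :=
  DeJong1996StrongAlgClosed.of_openLeaves hV hC hZ hE ProjectiveLineSimplyConnected_holds hH
    h13 h16 h17 h18 hN hN₂ hK hS

/-- … and Thm. 4.1 (i)+(ii) over every field, its last sentence over perfect fields, (i) alone
and the weak form, from the same thirteen leaves. [cite: DeJong1996, Thm. 4.1, p. 66] -/
theorem DeJong1996Strong.of_openLeaves₁₃
    (hV : DeJong1996VertexBlowupProjection.{u}) (hC : DeJong1996Lemma411VertexChoice.{u})
    (hZ : steinFactorization_geometricallyConnected.{u}) (hE : DeJong1996SteinFactorizationEtale.{u})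
    (hH : EtaleCoverHyperplaneSectionConnected.{u})
    (h13 : DeJong1996MultisectionHyperplane.{u}) (h16 : DeJong1996GaloisNormalization.{u})
    (h17 : DeJong1996StableExtension.{u}) (h18 : DeJong1996RationalMapExtension.{u})
    (hN : DeJong1996NodeLocalStructure.{u}) (hN₂ : DeJong1996NodeLocalStructureCodimTwo.{u})
    (hK : DeJong1996SemiStableCodimTwoBlowupCore.{u}) (hS : DeJong1996NodalBlowupSingularLocus.{u}) :
    DeJong1996Strong.{u} ∧ DeJong1996StrongPerfect.{u} ∧ DeJong1996Projective.{u} ∧ DeJong1996.{u} :=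
  DeJong1996Strong.of_openLeaves hV hC hZ hE ProjectiveLineSimplyConnected_holds hH
    h13 h16 h17 h18 hN hN₂ hK hS

end Literature.AlgebraicGeometry.Resolution

end
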